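import Summits.QuantumFields.GaugeBoot.Certificates.SparseReducedWindow
import Summits.QuantumFields.GaugeBoot.Certificates.KZL2rpD4b1o2UpDA
import Summits.QuantumFields.GaugeBoot.Certificates.KZL2rpD4b1o2UpDB
import HarnessLib

/-!
# Kernel replay of the certsdp certificate `kzL2_D4_b1o2_max_rp_G2` — part G: factor-row assembly and objective (gb_lean_emit_win 0.10)

HONEST FRAMING (cell `pub-gaugeboot`): certified bounds on lattice expectations at stated coupling,
gauge group, dimension and torus size; NOT a mass gap, NOT a continuum limit, NOT a string tension;
NOT Yang–Mills-summit-bearing (barriers `FixedCouplingUltralocality`, `PerturbativeInvisibility`).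

Certificate sha256 `507502fc85815f6eb6adeb6c00790ea42b4bbd91e7c80e9cc9ae46d99a2ee95a` (problem `kzL2_D4_b1o2_max_rp_G2`, sha256 `91484c3811b11a6b17682d5f0aa7fd7d1c825d658d4c138b094db37009cf1fea`): `GB` = all factor rows (data parts
`Certificates/KZL2rpD4b1o2UpD….lean` concatenated), the INTEGER objective row `cZ`, the certified bound `lowerQ`, and the kernel check
`gb_len` (factor rows fit the padded dimension 48). Windows: `Certificates/KZL2rpD4b1o2UpA….lean`; assembly + theorems: `Certificates/KZL2rpD4b1o2Up.lean`.
Data/plumbing only; nothing is claimed about lattice gauge theory in this file.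
-/

namespace Summit.QuantumFields.GaugeBoot.Certificates.KZL2rpD4b1o2Up

noncomputable section

open Summit.QuantumFields.GaugeBoot.Certificates.Sparse

/-- All factor rows (concatenation of the data parts' block lists). -/
def GB : List (List (List ℤ)) := GBa ++ GBb

/-- Objective as a sparse INTEGER row: (-1)·y_1. -/
def cZ : List (ℕ × ℤ) := [(1, Int.negSucc 0)]

/-- The certified lower bound on the objective (exact): `-725084119770902314878343/5440166188265831286177792` (≈ -0.1332834502988). -/
def lowerQ : ℚ := -725084119770902314878343/5440166188265831286177792

set_option maxHeartbeats 0 in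
/-- Kernel check: every factor row of every block has length `≤ 48`. -/
theorem gb_len : lenCheckAll KZL2rpD4b1o2Up.GB 48 70 = true := by
  decide +kernel

end

end Summit.QuantumFields.GaugeBoot.Certificates.KZL2rpD4b1o2Up
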